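import Summits.QuantumFields.YangMills.Theorems.BalabanUVNodesN16HolderMSOfThm4Output
import Summits.QuantumFields.YangMills.Theorems.BalabanUVNodesN16HolderRegime

/-!
# Route «BalabanUVNodes», cluster K4 «SpineRates» — node N16 = NE3: THE RECORD-LEVEL MS-KIT (repair R-β″), PRINT FORM — the interface slot `PrintSlotHolderMS c β`
# (dag-n16-c's `PrintSlotHolder c β` with the (1.36)₃ Hölder line read ALONG EVERY LATTICE LINE, `1 ≤ j ≤ L^k`), `N16HolderMSAt` at every bundle pinned in THE END's
# regime (ONE `(r, Cof)` for every `β ∈ [0, 1]`), the MS thresholds `radiusOfRecordHMS` ∕ `constOfRecordHMS` chosen MONOTONICALLY below ∕ above the β-kit's, the proviso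
# `InEndRegimeHMS`, the bridges `InEndRegimeHMS → InEndRegimeH → InEndRegime`, and the one-application closers in all three currencies

Cell `pub-ymgap`, seat `pub-ymgap-dag-n16-e` (R134 acceleration seat (a), strategy s2 = BY-NAME KNIT at the record; HUMAN RULING D-0062; chair R424 venue), generation 6,
module 24 = (E1-MS) of the located item «the Hölder-exponent pin of N16's N05-socket» (`HOME/pub-ymgap-dag-n16-c/LOCATED-N16-HOLDER-PIN.md`), typed by this seat under
dag-n16-c g4's ONE-DECLARER division (pub-ymgap INBOX DAGN16C-G4-ACK-N16E l.16473: «n16-e TAKES the MS twins of the RECORD KIT; n16-c KEEPS the producer column 30–36»).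
The TOKEN TWIN of dag-n16-c's (E1) `…N16HolderRegime` (p482644) over dag-n16-c's MS print-level top `…N16HolderMSOfThm4Output` (`n16_holderMS_of_thm4TorusAt_printMS`,
column 35) — MIRRORED, nothing edited.  DEFINITION lane (3 `def`s + `Iff.rfl` ∕ `Classical.choose_spec` bookkeeping; 0 sorry).  `--supports stmt-QuantumFields-19912`
(K3‴ `SpineGivenEndpointR13`).  `bears_on: R4∕N16 · edge N05 → N16 · out-edge N16 → N21`.

WHY.  Under R-β″ a `Record13`-keyed home quotes N16's slot and proviso at a printed exponent `β ∈ (0, 1]` with the Hölder member read along lines (the window-free road: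
NE7's consumers survive for every `β > 0`, `…N16HolderMultiScaleRates`).  dag-n16-c's (E1) packages the β-column bundle-wise; THIS FILE is the same packaging over the
MS column: the MS slot (§1), the pinned theorem with ONE `(r, Cof)` serving EVERY `β ∈ [0, 1]` (§2), thresholds CHOSEN from it by `min` ∕ `max` AGAINST THE β-KIT's (§3) — so
`InEndRegimeHMS → InEndRegimeH → InEndRegime` and every theorem keyed to either earlier proviso stays fed by ONE application (no twins anywhere) —, and the closers (§4): a
planner adopting R-β″ re-points `InEndRegime ↦ InEndRegimeHMS`, `PrintSlot ↦ PrintSlotHolderMS · β`, `N16At ↦ N16HolderMSAt · β` by name and nothing else on N16's side.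

WHAT THIS FILE DECLARES: §1 `PrintSlotHolderMS c β` · `printSlotHolderMS_iff`; §2 `n16HolderMSAt_of_pinned_printSlotHolderMS`; §3 `radiusOfRecordHMS := min radiusOfRecordH r′` ·
`constOfRecordHMS := max constOfRecordH Cof′` · `radiusOfRecordHMS_le` · `constOfRecordH_le_constOfRecordHMS` · `InEndRegimeHMS` · `inEndRegimeHMS_iff` · `regimeHMS_spec` ·
`radiusOfRecordHMS_pos` · `constOfRecordHMS_nonneg` · `inEndRegimeHMS_iff_of_familyL` · ★ THE BRIDGES `inEndRegimeH_of_inEndRegimeHMS`, `inEndRegime_of_inEndRegimeHMS`; §4 closers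
`n16HolderMSAt_of_inEndRegimeHMS_printSlotHolderMS` (`0 ≤ β ≤ 1`) · `n16HolderAt_of_inEndRegimeHMS_printSlotHolder` (the β-slot through the first bridge) ·
`n16At_of_inEndRegimeHMS_printSlot` (β = 1, the slot OF RECORD through both bridges) · `s_N16HolderMS_of_inEndRegimeHMS_printSlotHolderMS` · `s_N16Holder_of_inEndRegimeHMS_printSlotHolder` ·
`s_N16_of_inEndRegimeHMS_printSlot` (`RRec`-generic).
HONEST FRAMING: definitions and bookkeeping; `PrintSlotHolderMS` is a hypothesis SHAPE ([Balaban1985RegularSpaces] Thm 4 + Prop 3 in the all-torus geometry with the (1.36)₃ Hölder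
member AS PRINTED and read along lines as in [Balaban1985BackgroundPropagators] (3.40), and [Balaban1985Variational] Thm 1 (8)+(10) TYPE) asserted for no bundle; nothing of
Bałaban's proved; **N16 ∕ NE3 NOT discharged**; the repair's statement edit (R-β ∕ R-β″ ∕ R-Δ ∕ status quo) is the planner's ∕ director's, UNRULED; count-neutral (5∕27, A 5∕28
UNMOVED); one finite four-torus at fixed ε — NOT ℝ⁴, NOT infinite volume, NOT OS, NOT a mass gap, NOT Clay.
-/

set_option autoImplicit false

open scoped BigOperators Matrix Matrix.Norms.L2Operator
open NormedSpace

namespace Summit.QuantumFields.YangMills.BalabanUVNodes.N16HolderMSRegime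

open Literature.MathematicalPhysics.QuantumFieldTheory.Balaban1983to89
open Literature.MathematicalPhysics.QuantumFieldTheory.Balaban1983to89.T4Continuum (T4Family ULoop)
open B7Prop1Explicit B7Prop2Explicit
open T4AveragingDeficitWall (Ad)
open B7Eq92Concrete (mgauge)
open B8Ineq132 (covDerivFwd)
open B8Eq184Proof (cfgExp)
open B8Eq119TwistedAxial (Restr129)
open B8Eq133Hypotheses (Reg335Zd)
open B8Eq138LandauZd (covLap IsLandau138)
open B8Thm4TorusAt (torusLam Thm4TorusAt)
open Summit.QuantumFields.BalabanUV.T4Continuum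
open MinimalActionRate (sfClass)
open BlockAverageCurrent (curConst)
open NE3RightInverseSupLetters (frameC)
open NE3.LeafIndexSockets (LeafH3sup)
open YMDAG.UVSplit (Datum NE3Carriers RateCarriers RateRecordPred N16At S_N16)
open Summit.QuantumFields.YangMills.BalabanUVNodes.N16HolderDefs (CovRootHolder N16HolderAt S_N16Holder)
open Summit.QuantumFields.YangMills.BalabanUVNodes.N16HolderMSDefs (CovRootHolderMS N16HolderMSAt S_N16HolderMS)
open Summit.QuantumFields.YangMills.BalabanUVNodes.N16HolderMSOfThm4Output (n16_holderMS_of_thm4TorusAt_printMS)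
open Summit.QuantumFields.YangMills.BalabanUVNodes.N16Regime (PrintSlot InEndRegime radiusOfRecord constOfRecord)
open Summit.QuantumFields.YangMills.BalabanUVNodes.N16HolderRegime (PrintSlotHolder radiusOfRecordH constOfRecordH InEndRegimeH radiusOfRecordH_pos
  n16HolderAt_of_inEndRegimeH_printSlotHolder n16At_of_inEndRegimeH_printSlot inEndRegime_of_inEndRegimeH)

noncomputable section

/-! ## §1 The print-form interface slot at a bundle, Hölder member at exponent `β` read along every lattice line (MULTI-SCALE) -/

/-- **THE PRINT-FORM INTERFACE SLOT AT A BUNDLE `c : NE3Carriers N`, HÖLDER MEMBER AT EXPONENT `β`, MULTI-SCALE** — dag-n16-c's `N16HolderRegime.PrintSlotHolder c β` VERBATIM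
but for (i) the (1.36)₃ Hölder line of the concrete conclusion slot, read ALONG EVERY LATTICE LINE with the line holonomy as transport:
`‖Ad (hol U₀ y (seg μ j)) (D^η_{U₀,μ}A_κ)(y + j•e_μ) − (D^η_{U₀,μ}A_κ)(y)‖ ≤ B_h·(α₀+α₁)·(((c.L⁻¹)^k)^β · j^β)` for `1 ≤ j ≤ L^k` (the reading of [Balaban1985RegularSpaces]
(1.36) «β ≦ β₀ < 1», p. 82, along lines = [Balaban1985BackgroundPropagators] (3.40) restricted to collinear pairs — dag-n16-c's `…N16HolderMSThm4Print`), and (ii) the Hölder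
threshold line, which pays the j × 1 ladder of dag-n16-c's `…N16HolderMSDictionary`: `B_h·X + 10·α_{b′}·(B·X) ≤ c.Λ₂'` (`X = α + 11·4²·α`, `α_{b′} = b′ + 226(8·5·8)²b′²`;
the β-slot has `8·`): for SOME Theorem-4 constants `(c₁, B, B_h)`, leaf letters `(b′, c′)`, averaging letter `α` with `c.ε < α`, (3.35) schedule and the k-free letter
lines, THEOREM 4 IN THE ALL-TORUS GEOMETRY at every level `k ≥ 1` with that conclusion, AND N07's `LeafH3sup 4 c.L c.Nper c.ε b′ c′ c.dom`.  A hypothesis SHAPE — asserted for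
no bundle here. [cite: Balaban1985RegularSpaces, Thm 4 p.88, (1.36)–(1.38) p.82, (1.39) p.83] [cite: Balaban1985BackgroundPropagators, (3.40) p.397] -/
@[folklore]
def PrintSlotHolderMS {N : ℕ} (c : NE3Carriers N) (β : ℝ) : Prop :=
  ∃ (c₁ B Bh b' c' α Mc C335 : ℝ) (𝒬 : ℕ → Set (Set (Site 4) × ℕ)),
    0 ≤ b' ∧ 0 ≤ c' ∧ 2 ^ 15 * ((4 : ℝ) + 1) ^ 2 * ((4 : ℝ) + 4) ^ 2 * (c.L : ℝ) ^ 2 * b' ≤ 1 ∧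
    23040 * (4 : ℝ) ^ 4 * (frameC 4 c.L + 4) ^ 3 * (c' + curConst 4 c.L * b' ^ 2) ≤ 1 ∧
    0 < α ∧ C0 4 * α ≤ 1 / 3 ∧ 2 * α ≤ c2' 4 c.L ∧ 11 * (4 : ℝ) ^ 2 * α ≤ 1 / 6 ∧ α + 11 * (4 : ℝ) ^ 2 * α ≤ c₁ ∧
    (b' + 226 * (8 * ((4 : ℝ) + 1) * ((4 : ℝ) + 4)) ^ 2 * b' ^ 2) < α ∧ 4 * ((4 : ℝ) - 1) * (c' + curConst 4 c.L * b' ^ 2) < α ∧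
    0 ≤ Mc ∧ (Mc + 1) * (b' + 226 * (8 * ((4 : ℝ) + 1) * ((4 : ℝ) + 4)) ^ 2 * b' ^ 2) ≤ 1 / 2 ∧
    (∀ k, ∀ q ∈ 𝒬 k, q.2 ≤ k ∧ ∃ y : Site 4, ∀ z ∈ q.1, (l1 (z - y) : ℝ) ≤ Mc * (c.L : ℝ) ^ q.2) ∧
    2 * (Mc + 1) * (b' + 226 * (8 * ((4 : ℝ) + 1) * ((4 : ℝ) + 4)) ^ 2 * b' ^ 2) + 2 * Mc * (2 * (c' + curConst 4 c.L * b' ^ 2)) +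
      4 * Mc * (1 + 2 * Mc) * (b' + 226 * (8 * ((4 : ℝ) + 1) * ((4 : ℝ) + 4)) ^ 2 * b' ^ 2) ^ 2 < C335 ∧
    c.ε < α ∧ B * (α + 11 * (4 : ℝ) ^ 2 * α) ≤ c.Λ₁ ∧
    B * (α + 11 * (4 : ℝ) ^ 2 * α) + 2 * (b' + 226 * (8 * ((4 : ℝ) + 1) * ((4 : ℝ) + 4)) ^ 2 * b' ^ 2) * c.Λ₁ ≤ c.Λ₁ ∧
    B * (α + 11 * (4 : ℝ) ^ 2 * α) + 16 * (b' + 226 * (8 * ((4 : ℝ) + 1) * ((4 : ℝ) + 4)) ^ 2 * b' ^ 2) * (B * (α + 11 * (4 : ℝ) ^ 2 * α)) ≤ c.Λ₁ ∧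
    Bh * (α + 11 * (4 : ℝ) ^ 2 * α) + 10 * (b' + 226 * (8 * ((4 : ℝ) + 1) * ((4 : ℝ) + 4)) ^ 2 * b' ^ 2) * (B * (α + 11 * (4 : ℝ) ^ 2 * α)) ≤ c.Λ₂' ∧
    (∀ k, 1 ≤ k → Thm4TorusAt c.L k (((c.Nper * c.L ^ k : ℕ) : ℤ)) (((c.L : ℝ) ^ k)⁻¹) c₁ (unitaryUnits (Matrix (Fin N) (Fin N) ℂ))
      (Reg335Zd (((c.L : ℝ) ^ k)⁻¹) c.L (𝒬 k) C335) (Restr129 c.L k (torusLam k))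
      (fun (α₀ α₁ : ℝ) (U₀ U' : Site 4 → Fin 4 → (Matrix (Fin N) (Fin N) ℂ)ˣ) (u : Site 4 → (Matrix (Fin N) (Fin N) ℂ)ˣ) =>
        ∃ A : Site 4 → Fin 4 → Matrix (Fin N) (Fin N) ℂ,
          (∀ x μ, IsSelfAdjoint (A x μ)) ∧ (∀ (x : Site 4) (κ μ : Fin 4), A (x + (((c.Nper * c.L ^ k : ℕ) : ℤ)) • e κ) μ = A x μ) ∧
          mgauge U₀ u (cfgExp (((c.L : ℝ) ^ k)⁻¹) A) = U' ∧
          (∀ x μ, ‖A x μ‖ ≤ B * (α₀ + α₁)) ∧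
          (∀ (μ : Fin 4) (x : Site 4) (κ : Fin 4), ‖covDerivFwd (((c.L : ℝ) ^ k)⁻¹) U₀ μ (fun z => A z κ) x‖ ≤ B * (α₀ + α₁)) ∧
          IsLandau138 c.L k (((c.L : ℝ) ^ k)⁻¹) Set.univ (torusLam k) U₀ A ∧
          (∀ (κ μ : Fin 4) (y : Site 4) (j : ℕ), 1 ≤ j → j ≤ c.L ^ k →
            ‖Ad (hol U₀ y (seg μ (j : ℤ))) (covDerivFwd (((c.L : ℝ) ^ k)⁻¹) U₀ μ (fun z => A z κ) (y + j • e μ))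
                - covDerivFwd (((c.L : ℝ) ^ k)⁻¹) U₀ μ (fun z => A z κ) y‖
              ≤ Bh * (α₀ + α₁) * ((((c.L : ℝ)⁻¹) ^ k) ^ β * (j : ℝ) ^ β)) ∧
          (∀ (x : Site 4) (κ : Fin 4), ‖covLap (((c.L : ℝ) ^ k)⁻¹) U₀ (fun z => A z κ) x‖ ≤ B * (α₀ + α₁)))) ∧
    LeafH3sup 4 c.L c.Nper c.ε b' c' c.dom

/-! ## §2 `N16HolderMSAt` at every bundle pinned in THE END's regime carrying the MS β-slot — ONE `(r, Cof)` for every `β ∈ [0, 1]` -/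

section Pinned

variable {N : ℕ} [NeZero N]

/-- **THE MS β-SLOT CLOSES `N16HolderMSAt` AT EVERY BUNDLE PINNED IN THE END's REGIME, UNIFORMLY IN `β ∈ [0, 1]`** (block factor `L ≥ 2`, period `Nper ≥ 1`) — dag-n16-c's
`N16HolderRegime.n16HolderAt_of_pinned_printSlotHolder` with the MS slot and the MS root: there are `r > 0` and `Cof : ℝ → ℝ` (`0 ≤ Cof g` for `g > 0`) — THE END's radius and
constant, functions of `(L, Nper, N[, g])` ONLY, chosen BEFORE `β` and before Theorem 4's constants — such that every bundle `c` with `c.L = L`, `c.Nper = Nper`, `0 < c.g`,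
`0 < c.ε ≤ r`, `0 ≤ c.Λ₁ ≤ r`, `0 ≤ c.b ≤ c.ε∕2`, `Cof c.g ≤ c.C` satisfies `PrintSlotHolderMS c β → N16HolderMSAt c β` for EVERY `0 ≤ β ≤ 1`.  dag-n16-c's column-35 top
`n16_holderMS_of_thm4TorusAt_printMS` packaged bundle-wise (`choose`; constant raised by `CovRootHolderMS.mono`). [folklore] -/
theorem n16HolderMSAt_of_pinned_printSlotHolderMS {L Nper : ℕ} (hL : 2 ≤ L) (hN : 1 ≤ Nper) :
    ∃ r : ℝ, 0 < r ∧ ∃ Cof : ℝ → ℝ, (∀ g, 0 < g → 0 ≤ Cof g) ∧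
      ∀ c : NE3Carriers N, c.L = L → c.Nper = Nper → 0 < c.g → 0 < c.ε → c.ε ≤ r → 0 ≤ c.Λ₁ → c.Λ₁ ≤ r → 0 ≤ c.b → c.b ≤ c.ε / 2 →
        Cof c.g ≤ c.C → ∀ ⦃β : ℝ⦄, 0 ≤ β → β ≤ 1 → PrintSlotHolderMS c β → N16HolderMSAt c β := by
  haveI : Nonempty (Fin N) := ⟨⟨0, Nat.pos_of_ne_zero (NeZero.ne N)⟩⟩
  obtain ⟨r, hr0, hr⟩ := n16_holderMS_of_thm4TorusAt_printMS (n := Fin N) hL hN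
  choose Cof hCof0 hCof using hr
  refine ⟨r, hr0, fun g => if h : 0 < g then Cof h else 0, fun g hg => by simp only [dif_pos hg]; exact hCof0 hg, ?_⟩
  rintro ⟨cL, cN, ε, b, g, C, Λ₁, Λ₂', dom⟩ rfl rfl hg hε hεr hs₁ hs₁r hb hbh hC β hβ0 hβ
    ⟨c₁, B, Bh, b', c', α, Mc, C335, 𝒬, hb', hc', hRb, hcF, hα, hA3, hA2, hAs, hAc, hb'α, hc'α, hMc, hMcα, h𝒬, hC335, hεα, hss, hgrad, hℓ, hhol, hT4, h3⟩
  simp only [dif_pos hg] at hC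
  exact (hCof hg c₁ B Bh hb' hc' hRb hcF hα hA3 hA2 hAs hAc hb'α hc'α hMc hMcα 𝒬 h𝒬 hC335 hε hεr hεα hs₁ hs₁r hb hbh hss hgrad hℓ hhol hβ0 hβ hT4 h3).mono
    hC le_rfl le_rfl

end Pinned

/-! ## §3 THE END's MS thresholds CHOSEN as functions of `(L, Nper)`, monotonically against the β-kit's; the proviso; the bridges -/

section Thresholds

variable (N : ℕ) [NeZero N]

/-- **THE END's MS RADIUS, MONOTONE CHOICE `r_HMS(L, Nper, N) := min (radiusOfRecordH N L Nper) r′`**, `r′` the `r > 0` of §2 at `(L, Nper)` CHOSEN (`Classical.choose`); `0` off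
the side conditions `2 ≤ L ∧ 1 ≤ Nper`.  The `min` with dag-n16-c's β-radius (itself `≤` the radius OF RECORD) makes the MS regime IMPLY both earlier regimes. [folklore] -/
def radiusOfRecordHMS (L Nper : ℕ) : ℝ :=
  if h : 2 ≤ L ∧ 1 ≤ Nper then min (radiusOfRecordH N L Nper) (Classical.choose (n16HolderMSAt_of_pinned_printSlotHolderMS (N := N) h.1 h.2)) else 0

/-- **THE END's MS CONSTANT, MONOTONE CHOICE `Cof_HMS(L, Nper, N, g) := max (constOfRecordH N L Nper g) (Cof′ g)`**, `Cof′` the `Cof` of §2 at `(L, Nper)` CHOSEN; `0` off the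
side conditions.  `constOfRecordH ≤ Cof_HMS` (the bridge) and `Cof′ ≤ Cof_HMS` (§2's closers). [folklore] -/
def constOfRecordHMS (L Nper : ℕ) (g : ℝ) : ℝ :=
  if h : 2 ≤ L ∧ 1 ≤ Nper then
    max (constOfRecordH N L Nper g) (Classical.choose (Classical.choose_spec (n16HolderMSAt_of_pinned_printSlotHolderMS (N := N) h.1 h.2)).2 g)
  else 0

/-- `r_HMS ≤` dag-n16-c's β-radius `r_H` (on the side conditions). [folklore] -/
theorem radiusOfRecordHMS_le {L Nper : ℕ} (hL : 2 ≤ L) (hN : 1 ≤ Nper) : radiusOfRecordHMS N L Nper ≤ radiusOfRecordH N L Nper := by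
  simp only [radiusOfRecordHMS, dif_pos (And.intro hL hN)]
  exact min_le_left _ _

/-- dag-n16-c's β-constant `Cof_H ≤ Cof_HMS` (on the side conditions). [folklore] -/
theorem constOfRecordH_le_constOfRecordHMS {L Nper : ℕ} (hL : 2 ≤ L) (hN : 1 ≤ Nper) (g : ℝ) :
    constOfRecordH N L Nper g ≤ constOfRecordHMS N L Nper g := by
  simp only [constOfRecordHMS, dif_pos (And.intro hL hN)]
  exact le_max_left _ _

variable {N}

/-- **THE END's REGIME AT A BUNDLE, MS THRESHOLDS** — n16-e's proviso `N16Regime.InEndRegime c` ∕ dag-n16-c's `InEndRegimeH c` VERBATIM with the thresholds replaced by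
`radiusOfRecordHMS` ∕ `constOfRecordHMS`: block factor `≥ 2`, period `≥ 1`, positive coupling letter, class radius and gradient letter inside `radiusOfRecordHMS`, regularity
`0 ≤ b ≤ ε∕2`, constant at least `constOfRecordHMS`. [folklore] -/
@[folklore]
def InEndRegimeHMS (c : NE3Carriers N) : Prop :=
  2 ≤ c.L ∧ 1 ≤ c.Nper ∧ 0 < c.g ∧ 0 < c.ε ∧ c.ε ≤ radiusOfRecordHMS N c.L c.Nper ∧ 0 ≤ c.Λ₁ ∧ c.Λ₁ ≤ radiusOfRecordHMS N c.L c.Nper ∧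
    0 ≤ c.b ∧ c.b ≤ c.ε / 2 ∧ constOfRecordHMS N c.L c.Nper c.g ≤ c.C

/-- `InEndRegimeHMS c` unfolded (`Iff.rfl`). [folklore] -/
theorem inEndRegimeHMS_iff (c : NE3Carriers N) :
    InEndRegimeHMS c ↔
      2 ≤ c.L ∧ 1 ≤ c.Nper ∧ 0 < c.g ∧ 0 < c.ε ∧ c.ε ≤ radiusOfRecordHMS N c.L c.Nper ∧ 0 ≤ c.Λ₁ ∧ c.Λ₁ ≤ radiusOfRecordHMS N c.L c.Nper ∧
        0 ≤ c.b ∧ c.b ≤ c.ε / 2 ∧ constOfRecordHMS N c.L c.Nper c.g ≤ c.C :=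
  Iff.rfl

/-- **THE CHOSEN PACKAGE** (`2 ≤ L`, `1 ≤ Nper`): `radiusOfRecordHMS N L Nper > 0`, `constOfRecordHMS N L Nper g ≥ 0` for `g > 0`, and every bundle `c` with `c.L = L`,
`c.Nper = Nper` in THE END's regime at these thresholds carrying `PrintSlotHolderMS c β`, `0 ≤ β ≤ 1`, satisfies `N16HolderMSAt c β` — `Classical.choose_spec` of §2 through
`min ≤ r′`, `Cof′ ≤ max`; dag-n16-c's `radiusOfRecordH_pos` for the sign of the `min`. [folklore] -/
theorem regimeHMS_spec {L Nper : ℕ} (hL : 2 ≤ L) (hN : 1 ≤ Nper) :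
    0 < radiusOfRecordHMS N L Nper ∧ (∀ g : ℝ, 0 < g → 0 ≤ constOfRecordHMS N L Nper g) ∧
      ∀ c : NE3Carriers N, c.L = L → c.Nper = Nper → 0 < c.g → 0 < c.ε → c.ε ≤ radiusOfRecordHMS N L Nper → 0 ≤ c.Λ₁ →
        c.Λ₁ ≤ radiusOfRecordHMS N L Nper → 0 ≤ c.b → c.b ≤ c.ε / 2 → constOfRecordHMS N L Nper c.g ≤ c.C →
        ∀ ⦃β : ℝ⦄, 0 ≤ β → β ≤ 1 → PrintSlotHolderMS c β → N16HolderMSAt c β := by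
  have hspec := Classical.choose_spec (n16HolderMSAt_of_pinned_printSlotHolderMS (N := N) hL hN)
  have hCof := Classical.choose_spec hspec.2
  simp only [radiusOfRecordHMS, constOfRecordHMS, dif_pos (And.intro hL hN)]
  refine ⟨lt_min (radiusOfRecordH_pos (N := N) hL hN) hspec.1, fun g hg => (hCof.1 g hg).trans (le_max_right _ _), ?_⟩
  intro c h1 h2 hg hε hεr hs₁ hs₁r hb hbh hC β hβ0 hβ hslot
  exact hCof.2 c h1 h2 hg hε (hεr.trans (min_le_right _ _)) hs₁ (hs₁r.trans (min_le_right _ _)) hb hbh ((le_max_right _ _).trans hC) hβ0 hβ hslot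

/-- `radiusOfRecordHMS N L Nper > 0` on the side conditions. [folklore] -/
theorem radiusOfRecordHMS_pos {L Nper : ℕ} (hL : 2 ≤ L) (hN : 1 ≤ Nper) : 0 < radiusOfRecordHMS N L Nper :=
  (regimeHMS_spec (N := N) hL hN).1

/-- `constOfRecordHMS N L Nper g ≥ 0` for `g > 0` on the side conditions. [folklore] -/
theorem constOfRecordHMS_nonneg {L Nper : ℕ} (hL : 2 ≤ L) (hN : 1 ≤ Nper) {g : ℝ} (hg : 0 < g) : 0 ≤ constOfRecordHMS N L Nper g :=
  (regimeHMS_spec (N := N) hL hN).2.1 g hg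

/-- **THE PROVISO WITH THE BLOCK FACTOR KEYED TO THE FAMILY** (`HistoryFlow.two_le_L`: every four-torus family has `L ≥ 2`): for a bundle with `c.L = F.L` the first clause of
`InEndRegimeHMS c` is the family's. [folklore] -/
theorem inEndRegimeHMS_iff_of_familyL {F : T4Family} {c : NE3Carriers N} (hL : c.L = F.L) :
    InEndRegimeHMS c ↔
      1 ≤ c.Nper ∧ 0 < c.g ∧ 0 < c.ε ∧ c.ε ≤ radiusOfRecordHMS N F.L c.Nper ∧ 0 ≤ c.Λ₁ ∧ c.Λ₁ ≤ radiusOfRecordHMS N F.L c.Nper ∧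
        0 ≤ c.b ∧ c.b ≤ c.ε / 2 ∧ constOfRecordHMS N F.L c.Nper c.g ≤ c.C := by
  rw [inEndRegimeHMS_iff, hL]
  exact ⟨fun h => h.2, fun h => ⟨HistoryFlow.two_le_L F, h⟩⟩

/-- ★ **THE FIRST BRIDGE — `InEndRegimeHMS c → InEndRegimeH c`**: the MS regime IMPLIES dag-n16-c's β-uniform regime (`r_HMS ≤ r_H`, `Cof_H ≤ Cof_HMS`), so EVERY
`InEndRegimeH`-keyed theorem in the tree (dag-n16-c's (E1)∕(E2) closers, this seat's (F1)∕(F2) and modules 20 ∕ 23 Holder faces) is fed from the MS regime by ONE application.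
[folklore] -/
theorem inEndRegimeH_of_inEndRegimeHMS {c : NE3Carriers N} (h : InEndRegimeHMS c) : InEndRegimeH c := by
  obtain ⟨hL, hN, hg, hε, hεr, hs₁, hs₁r, hb, hbh, hC⟩ := h
  have hr := radiusOfRecordHMS_le (N := N) hL hN
  exact ⟨hL, hN, hg, hε, hεr.trans hr, hs₁, hs₁r.trans hr, hb, hbh, (constOfRecordH_le_constOfRecordHMS (N := N) hL hN c.g).trans hC⟩

/-- ★ **THE SECOND BRIDGE — `InEndRegimeHMS c → InEndRegime c`** (through dag-n16-c's `inEndRegime_of_inEndRegimeH`): the MS regime IMPLIES n16-e's regime OF RECORD, so every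
`InEndRegime`-keyed theorem (files 1–23 of this seat, n21-d's letters of record, the N14∕N17∕N18 readers of the proviso) stays fed — no twins anywhere. [folklore] -/
theorem inEndRegime_of_inEndRegimeHMS {c : NE3Carriers N} (h : InEndRegimeHMS c) : InEndRegime c :=
  inEndRegime_of_inEndRegimeH (inEndRegimeH_of_inEndRegimeHMS h)

end Thresholds

/-! ## §4 The one-application closers — MS currency at `β ∈ [0, 1]`, β currency through the first bridge, the exponent of record through both -/

section Closers

variable {N : ℕ} [NeZero N]

/-- **THE ONE-APPLICATION CLOSER, MS CURRENCY — `InEndRegimeHMS c → PrintSlotHolderMS c β → N16HolderMSAt c β`** (`0 ≤ β ≤ 1`): a bundle in THE END's MS regime carrying the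
print-form MS β-slot satisfies the R-β″ analogue of N16's record decl.  What a `Record13`-keyed home's NE3 bundle needs under R-β″: its PROVISO (`InEndRegimeHMS`) and its CONTENT
(`PrintSlotHolderMS · β` = N05's Theorem 4 at the bundle's pairs with the Hölder member as PRINTED and read along lines + N07's `LeafH3sup`). [folklore] -/
theorem n16HolderMSAt_of_inEndRegimeHMS_printSlotHolderMS {c : NE3Carriers N} (hreg : InEndRegimeHMS c) {β : ℝ} (hβ0 : 0 ≤ β) (hβ : β ≤ 1)
    (hslot : PrintSlotHolderMS c β) : N16HolderMSAt c β := by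
  obtain ⟨hL, hN, hg, hε, hεr, hs₁, hs₁r, hb, hbh, hC⟩ := hreg
  exact (regimeHMS_spec (N := N) hL hN).2.2 c rfl rfl hg hε hεr hs₁ hs₁r hb hbh hC hβ0 hβ hslot

/-- **… THE β-CURRENCY THROUGH THE FIRST BRIDGE — `InEndRegimeHMS c → PrintSlotHolder c β → N16HolderAt c β`** (`β ≤ 1`; dag-n16-c's (E1) closer after
`inEndRegimeH_of_inEndRegimeHMS`): re-pointing a home's proviso `InEndRegimeH ↦ InEndRegimeHMS` loses nothing at the β-slot. [folklore] -/
theorem n16HolderAt_of_inEndRegimeHMS_printSlotHolder {c : NE3Carriers N} (hreg : InEndRegimeHMS c) {β : ℝ} (hβ : β ≤ 1) (hslot : PrintSlotHolder c β) :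
    N16HolderAt c β :=
  n16HolderAt_of_inEndRegimeH_printSlotHolder (inEndRegimeH_of_inEndRegimeHMS hreg) hβ hslot

/-- **… AND AT THE EXPONENT OF RECORD — `InEndRegimeHMS c → PrintSlot c → N16At c`**: the MS regime ALSO closes n16-e's slot OF RECORD to N16's decl OF RECORD (dag-n16-c's
`n16At_of_inEndRegimeH_printSlot` after the first bridge).  So re-pointing `InEndRegime ↦ InEndRegimeHMS` loses nothing at `β = 1` either. [folklore] -/
theorem n16At_of_inEndRegimeHMS_printSlot {c : NE3Carriers N} (hreg : InEndRegimeHMS c) (hslot : PrintSlot c) : N16At c :=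
  n16At_of_inEndRegimeH_printSlot (inEndRegimeH_of_inEndRegimeHMS hreg) hslot

/-- **`S_N16HolderMS β RRec` FOR EVERY RATE-RECORD PREDICATE WHOSE BUNDLES ARE IN THE MS REGIME AND CARRY THE MS β-SLOT** (`0 ≤ β ≤ 1`; `RRec`-generic; one application per
home) — the R-β″ analogue of n16-e's `s_N16_of_inEndRegime_printSlot` ∕ dag-n16-c's `s_N16Holder_of_inEndRegimeH_printSlotHolder`. [folklore] -/
theorem s_N16HolderMS_of_inEndRegimeHMS_printSlotHolderMS (RRec : RateRecordPred N) {β : ℝ} (hβ0 : 0 ≤ β) (hβ : β ≤ 1)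
    (h : ∀ (F : T4Family) (D : Datum F N) (g₀ : ℕ → ℝ) (os : List (ULoop F)) (R : RateCarriers N), RRec F D g₀ os R →
      InEndRegimeHMS R.ne3 ∧ PrintSlotHolderMS R.ne3 β) :
    S_N16HolderMS β RRec :=
  fun F D g₀ os R hR => n16HolderMSAt_of_inEndRegimeHMS_printSlotHolderMS (h F D g₀ os R hR).1 hβ0 hβ (h F D g₀ os R hR).2

/-- **`S_N16Holder β RRec` FROM THE MS REGIME AND THE β-SLOT** (`β ≤ 1`; `RRec`-generic) — dag-n16-c's RRec-generic closer at the MS thresholds. [folklore] -/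
theorem s_N16Holder_of_inEndRegimeHMS_printSlotHolder (RRec : RateRecordPred N) {β : ℝ} (hβ : β ≤ 1)
    (h : ∀ (F : T4Family) (D : Datum F N) (g₀ : ℕ → ℝ) (os : List (ULoop F)) (R : RateCarriers N), RRec F D g₀ os R →
      InEndRegimeHMS R.ne3 ∧ PrintSlotHolder R.ne3 β) :
    S_N16Holder β RRec :=
  fun F D g₀ os R hR => n16HolderAt_of_inEndRegimeHMS_printSlotHolder (h F D g₀ os R hR).1 hβ (h F D g₀ os R hR).2

/-- **`S_N16 RRec` (THE STUB OF RECORD) FROM THE MS REGIME AND THE SLOT OF RECORD** (`RRec`-generic) — n16-e's `s_N16_of_inEndRegime_printSlot` at the MS thresholds. [folklore] -/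
theorem s_N16_of_inEndRegimeHMS_printSlot (RRec : RateRecordPred N)
    (h : ∀ (F : T4Family) (D : Datum F N) (g₀ : ℕ → ℝ) (os : List (ULoop F)) (R : RateCarriers N), RRec F D g₀ os R →
      InEndRegimeHMS R.ne3 ∧ PrintSlot R.ne3) :
    S_N16 RRec :=
  fun F D g₀ os R hR => n16At_of_inEndRegimeHMS_printSlot (h F D g₀ os R hR).1 (h F D g₀ os R hR).2

end Closers

end

end Summit.QuantumFields.YangMills.BalabanUVNodes.N16HolderMSRegime
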